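import Mathlib
import Summits.Ventures.PercRepro2.LocRows
import Summits.Ventures.PercRepro2.SwRow
import Summits.Ventures.PercRepro2.SwOut

/-!
# The star classes of statement (HLC), part 1: the star of `h` and its realisation
(blind cell PercRepro2, night-4 g9, 2026-08-25; proofs/NIGHT4-G9.md §8)

Take `U = N[h]`, the closed neighbourhood of `h`, with `N(h)` INDEPENDENT (no edge among the
neighbours, no loops there, at most one edge `h–x`), `l ∉ U`, and a colouring `ξ` of the edges not
touching `U`.  On the outside class `outClass U h ξ` every neighbour `x` of `h` lies in exactly one of
`C_R(h)`, `C_B(h)` and its outside edges carry the colour OPPOSITE to `hx`; so the class is the cube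
of colourings of the star of `h` (`starRealize`), with `C_B(h) = {h} ∪ S`, `C_R(h) = {h} ∪ Sᶜ` for
`S` = the blue star edges.  Given `ξ`, `o ∈ C_R(l)` is increasing in `S` (the blue star edges make
their neighbours RED connectors) and `o ∈ C_B(l)` decreasing, so `Q` is a lower set of the star cube
(red = `true`); Harris on the cube and the swap `ω ↦ blue ω` give the counting inequality of (HLC) on
the class, and Hall gives the injection.

This file: the vocabulary (`nbr`, `closedNbr`, `StarEdge`, `IsStarAt`, `starEdge`), the realisation
`starRealize` of a star colouring, the two clusters of `h` (`cluster_starRealize`,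
`cluster_blue_starRealize` = the red / blue sides `redStar` / `blueStar` of the star) and the fact
that the class IS the star cube (`starRealize_mem_outClass`, `starRealize_injective`,
`eq_starRealize_of_mem_outClass`).  Part 2 (`SwOutStar.lean`): the monotonicity, Harris and the
theorem `swOut_star`.
-/

namespace Summit.Ventures.PercRepro2

namespace LocRows

open Hull

variable {V : Type*} {E : Type*} [Fintype E] [DecidableEq E] [DecidableEq V]

open scoped Classical

variable (ends : E → Sym2 V)

/-! ## The star of `h` -/

/-- The neighbours of `h` (other than `h`). -/
def nbr (h : V) : Set V := {x | x ≠ h ∧ ∃ e, ends e = s(h, x)}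

/-- The closed neighbourhood `N[h]`. -/
def closedNbr (h : V) : Set V := insert h (nbr ends h)

/-- The star edges of `h`. -/
def StarEdge (h : V) : Type _ := {e : E // h ∈ ends e}

/-- The star edges form a finite type. -/
instance (h : V) : Fintype (StarEdge ends h) := Subtype.fintype _

/-- Star edges have decidable equality. -/
instance (h : V) : DecidableEq (StarEdge ends h) := Subtype.instDecidableEq

/-- `h` is a STAR CENTRE: no loop at `h`, at most one edge to each neighbour, no edge touching two
neighbours (in particular no loop at a neighbour). -/
structure IsStarAt (h : V) : Prop where
  noloop : ∀ e, ends e ≠ s(h, h)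
  simple : ∀ e e' x, ends e = s(h, x) → ends e' = s(h, x) → e = e'
  indep : ∀ e x y, ends e = s(x, y) → x ∈ nbr ends h → y ∈ nbr ends h → False

variable {ends}

omit [Fintype E] [DecidableEq E] [DecidableEq V] in
/-- Membership in the neighbourhood. -/
lemma mem_nbr {h x : V} : x ∈ nbr ends h ↔ x ≠ h ∧ ∃ e, ends e = s(h, x) := Iff.rfl

omit [Fintype E] [DecidableEq E] [DecidableEq V] in
/-- Membership in the closed neighbourhood. -/
lemma mem_closedNbr {h x : V} : x ∈ closedNbr ends h ↔ x = h ∨ x ∈ nbr ends h := by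
  simp [closedNbr]

omit [Fintype E] [DecidableEq E] [DecidableEq V] in
/-- A star edge joins `h` to a neighbour (no loops at `h`). -/
lemma exists_nbr_of_star {h : V} (hs : IsStarAt ends h) (e : StarEdge ends h) :
    ∃ x ∈ nbr ends h, ends e.1 = s(h, x) := by
  obtain ⟨e, he⟩ := e
  obtain ⟨b, hb⟩ := Sym2.mem_iff_exists.1 he
  refine ⟨b, ⟨?_, e, hb⟩, hb⟩
  rintro rfl; exact hs.noloop e hb

omit [Fintype E] [DecidableEq E] [DecidableEq V] in
/-- The star edge of a neighbour (by `simple`, the only one). -/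
lemma exists_unique_starEdge {h x : V} (hs : IsStarAt ends h) (hx : x ∈ nbr ends h) :
    ∃! e : StarEdge ends h, ends e.1 = s(h, x) := by
  obtain ⟨_, e, he⟩ := hx
  refine ⟨⟨e, by rw [he]; exact Sym2.mem_mk_left _ _⟩, he, ?_⟩
  rintro ⟨e', he'⟩ h'
  exact Subtype.ext (hs.simple e' e x h' he)

/-- The star edge of a neighbour. -/
noncomputable def starEdge {h : V} (hs : IsStarAt ends h) {x : V} (hx : x ∈ nbr ends h) :
    StarEdge ends h :=
  Classical.choose (exists_unique_starEdge hs hx).exists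

omit [Fintype E] [DecidableEq E] [DecidableEq V] in
/-- The star edge of `x` joins `h` and `x`. -/
lemma starEdge_spec {h : V} (hs : IsStarAt ends h) {x : V} (hx : x ∈ nbr ends h) :
    ends (starEdge hs hx).1 = s(h, x) :=
  Classical.choose_spec (exists_unique_starEdge hs hx).exists

omit [Fintype E] [DecidableEq E] [DecidableEq V] in
/-- Any star edge to `x` is THE star edge of `x`. -/
lemma eq_starEdge {h : V} (hs : IsStarAt ends h) {x : V} (hx : x ∈ nbr ends h)
    {e : StarEdge ends h} (he : ends e.1 = s(h, x)) : e = starEdge hs hx :=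
  (exists_unique_starEdge hs hx).unique he (starEdge_spec hs hx)

omit [Fintype E] [DecidableEq E] [DecidableEq V] in
/-- A non-star edge at a neighbour `x` has its other endpoint outside `N[h]` and meets no other
neighbour. -/
lemma nbr_unique_of_edge {h : V} (hs : IsStarAt ends h) {e : E} {x y : V}
    (hx : x ∈ nbr ends h) (hxe : x ∈ ends e) (hy : y ∈ nbr ends h) (hye : y ∈ ends e) : x = y := by
  by_contra hne
  exact hs.indep e x y ((Sym2.mem_and_mem_iff hne).1 ⟨hxe, hye⟩) hx hy

/-- The class configuration of a star colouring `ω`: `ω` on the star, the OPPOSITE of `ω (hx)` on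
the other edges at the neighbour `x`, `ξ` elsewhere. -/
noncomputable def starRealize {h : V} (hs : IsStarAt ends h) (ξ : Config E)
    (ω : Config (StarEdge ends h)) : Config E :=
  fun e => if he : h ∈ ends e then ω ⟨e, he⟩
    else if hx : ∃ x, x ∈ nbr ends h ∧ x ∈ ends e then !(ω (starEdge hs hx.choose_spec.1))
    else ξ e

omit [Fintype E] [DecidableEq E] in
/-- On a star edge the realisation is the star colouring. -/
lemma starRealize_star {h : V} (hs : IsStarAt ends h) (ξ : Config E) (ω : Config (StarEdge ends h))
    {e : E} (he : h ∈ ends e) : starRealize hs ξ ω e = ω ⟨e, he⟩ := by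
  simp only [starRealize, he, dite_true]

omit [Fintype E] [DecidableEq E] in
/-- On a star edge the realisation is the star colouring. -/
lemma starRealize_starEdge {h : V} (hs : IsStarAt ends h) (ξ : Config E)
    (ω : Config (StarEdge ends h)) (e : StarEdge ends h) : starRealize hs ξ ω e.1 = ω e := by
  rw [starRealize_star hs ξ ω e.2]
  rfl

omit [Fintype E] [DecidableEq E] in
/-- On a non-star edge at a neighbour `x` the realisation is the opposite of the star edge of `x`. -/
lemma starRealize_bnd {h : V} (hs : IsStarAt ends h) (ξ : Config E) (ω : Config (StarEdge ends h))
    {e : E} (he : h ∉ ends e) {x : V} (hx : x ∈ nbr ends h) (hxe : x ∈ ends e) :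
    starRealize hs ξ ω e = !(ω (starEdge hs hx)) := by
  have hex : ∃ x, x ∈ nbr ends h ∧ x ∈ ends e := ⟨x, hx, hxe⟩
  simp only [starRealize, he, dite_false, hex, dite_true]
  have := nbr_unique_of_edge hs hex.choose_spec.1 hex.choose_spec.2 hx hxe
  subst this
  rfl

omit [Fintype E] [DecidableEq E] in
/-- Away from `N[h]` the realisation is `ξ`. -/
lemma starRealize_out {h : V} (hs : IsStarAt ends h) (ξ : Config E) (ω : Config (StarEdge ends h))
    {e : E} (he : h ∉ ends e) (hn : ∀ x ∈ nbr ends h, x ∉ ends e) : starRealize hs ξ ω e = ξ e := by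
  have hex : ¬ ∃ x, x ∈ nbr ends h ∧ x ∈ ends e := fun ⟨x, hx, hxe⟩ => hn x hx hxe
  simp only [starRealize, he, dite_false, hex]

/-- The red side of the star: `h` and the neighbours whose star edge is red. -/
def redStar {h : V} (hs : IsStarAt ends h) (ω : Config (StarEdge ends h)) : Set V :=
  {x | x = h ∨ ∃ hx : x ∈ nbr ends h, ω (starEdge hs hx) = true}

/-- The blue side of the star. -/
def blueStar {h : V} (hs : IsStarAt ends h) (ω : Config (StarEdge ends h)) : Set V :=
  {x | x = h ∨ ∃ hx : x ∈ nbr ends h, ω (starEdge hs hx) = false}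

omit [Fintype E] [DecidableEq E] in
/-- An open edge at `h` in the realisation leads to a neighbour whose star edge is open. -/
lemma adj_h_starRealize {h : V} (hs : IsStarAt ends h) (ξ : Config E) (ω : Config (StarEdge ends h))
    {c : Bool} {v : V} {e : E} (hv : v ≠ h) (he : ends e = s(h, v))
    (hc : starRealize hs ξ ω e = c) : ∃ hv' : v ∈ nbr ends h, ω (starEdge hs hv') = c := by
  have hv' : v ∈ nbr ends h := ⟨hv, e, he⟩
  have hmem : h ∈ ends e := by rw [he]; exact Sym2.mem_mk_left _ _
  refine ⟨hv', ?_⟩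
  have heq : (⟨e, hmem⟩ : StarEdge ends h) = starEdge hs hv' := eq_starEdge hs hv' he
  rw [← heq, ← starRealize_star hs ξ ω hmem, hc]

omit [Fintype E] [DecidableEq E] in
/-- A non-star edge at a neighbour `x` is open in the realisation iff the star edge of `x` is closed
(in the given colour). -/
lemma bnd_starRealize {h : V} (hs : IsStarAt ends h) (ξ : Config E) (ω : Config (StarEdge ends h))
    {x v : V} {e : E} (hx : x ∈ nbr ends h) (he : ends e = s(x, v)) (hh : h ∉ ends e) :
    starRealize hs ξ ω e = !(ω (starEdge hs hx)) :=
  starRealize_bnd hs ξ ω hh hx (by rw [he]; exact Sym2.mem_mk_left _ _)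

omit [Fintype E] [DecidableEq E] in
/-- The red cluster of `h` in the realisation is the red side of the star. -/
lemma cluster_starRealize {h : V} (hs : IsStarAt ends h) (ξ : Config E)
    (ω : Config (StarEdge ends h)) : cluster ends (starRealize hs ξ ω) h = redStar hs ω := by
  apply Set.Subset.antisymm
  · intro u hu
    refine mem_of_conn_of_closed (ends := ends) (ω := starRealize hs ξ ω) ?_ (Or.inl rfl) hu
    rintro a (rfl | ⟨ha, hao⟩) b hab
    · -- from `h` along an open star edge
      obtain ⟨hne, e, he, hends⟩ := openGraph_adj.1 hab
      obtain ⟨hb, hb'⟩ := adj_h_starRealize hs ξ ω (Ne.symm hne) hends he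
      exact Or.inr ⟨hb, hb'⟩
    · -- from a red neighbour `a`: only its star edge is open
      obtain ⟨hne, e, he, hends⟩ := openGraph_adj.1 hab
      by_cases hh : h ∈ ends e
      · -- `e` joins `a` and `h`
        have hba : b = h := by
          rw [hends] at hh
          rcases Sym2.mem_iff.1 hh with h1 | h1
          · exact absurd h1.symm ha.1
          · exact h1.symm
        exact Or.inl hba
      · exfalso
        have := bnd_starRealize hs ξ ω ha hends hh
        rw [he, hao] at this
        simp at this
  · rintro u (rfl | ⟨hu, hu'⟩)
    · exact mem_cluster_self ends _ _
    · refine conn_of_openAdj ⟨(starEdge hs hu).1, ?_, starEdge_spec hs hu⟩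
      rw [starRealize_starEdge]; exact hu'

omit [Fintype E] [DecidableEq E] in
/-- The colour swap commutes with the realisation. -/
lemma blue_starRealize {h : V} (hs : IsStarAt ends h) (ξ : Config E) (ω : Config (StarEdge ends h)) :
    blue (starRealize hs ξ ω) = starRealize hs (blue ξ) (blue ω) := by
  funext e
  by_cases he : h ∈ ends e
  · rw [blue_apply, starRealize_star hs ξ ω he, starRealize_star hs (blue ξ) (blue ω) he]; rfl
  · by_cases hx : ∃ x, x ∈ nbr ends h ∧ x ∈ ends e
    · obtain ⟨x, hx, hxe⟩ := hx
      rw [blue_apply, starRealize_bnd hs ξ ω he hx hxe, starRealize_bnd hs (blue ξ) (blue ω) he hx hxe]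
      simp [blue_apply]
    · have hn : ∀ x ∈ nbr ends h, x ∉ ends e := fun x hx' hxe => hx ⟨x, hx', hxe⟩
      rw [blue_apply, starRealize_out hs ξ ω he hn, starRealize_out hs (blue ξ) (blue ω) he hn]; rfl

omit [Fintype E] [DecidableEq E] in
/-- The blue cluster of `h` in the realisation is the blue side of the star. -/
lemma cluster_blue_starRealize {h : V} (hs : IsStarAt ends h) (ξ : Config E)
    (ω : Config (StarEdge ends h)) :
    cluster ends (blue (starRealize hs ξ ω)) h = blueStar hs ω := by
  rw [blue_starRealize, cluster_starRealize]
  ext x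
  simp only [redStar, blueStar, Set.mem_setOf_eq, blue_apply, Bool.not_eq_true']

/-- The realisation lies in the outside class of `N[h]`. -/
lemma starRealize_mem_outClass {h : V} (hs : IsStarAt ends h) (ξ : Config E)
    (ω : Config (StarEdge ends h)) :
    starRealize hs ξ ω ∈ outClass ends (closedNbr ends h) h ξ := by
  rw [mem_outClass]
  constructor
  · intro e he
    have hh : h ∉ ends e := fun hh => he (mem_touches.2 ⟨h, Or.inl rfl, _, (Sym2.mem_iff_exists.1 hh).choose_spec⟩)
    have hn : ∀ x ∈ nbr ends h, x ∉ ends e := fun x hx hxe =>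
      he (mem_touches.2 ⟨x, Or.inr hx, _, (Sym2.mem_iff_exists.1 hxe).choose_spec⟩)
    exact starRealize_out hs ξ ω hh hn
  · rw [hull, cluster_starRealize, cluster_blue_starRealize]
    rintro x (⟨rfl | ⟨hx, _⟩⟩ | ⟨rfl | ⟨hx, _⟩⟩)
    · exact Or.inl rfl
    · exact Or.inr hx
    · exact Or.inl rfl
    · exact Or.inr hx

omit [Fintype E] [DecidableEq E] in
/-- The realisation is injective. -/
lemma starRealize_injective {h : V} (hs : IsStarAt ends h) (ξ : Config E) :
    Function.Injective (starRealize hs ξ) := by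
  intro ω₁ ω₂ hω
  funext e
  have := congrFun hω e.1
  rwa [starRealize_starEdge, starRealize_starEdge] at this

/-- Every member of the outside class of `N[h]` is the realisation of its star colouring. -/
lemma eq_starRealize_of_mem_outClass {h : V} (hs : IsStarAt ends h) (ξ : Config E) {ζ : Config E}
    (hζ : ζ ∈ outClass ends (closedNbr ends h) h ξ) :
    ζ = starRealize hs ξ (fun e => ζ e.1) := by
  rw [mem_outClass] at hζ
  obtain ⟨hout, hhull⟩ := hζ
  funext e
  by_cases he : h ∈ ends e
  · rw [starRealize_star hs ξ _ he]
  · by_cases hx : ∃ x, x ∈ nbr ends h ∧ x ∈ ends e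
    · obtain ⟨x, hx, hxe⟩ := hx
      rw [starRealize_bnd hs ξ _ he hx hxe]
      -- the other endpoint `v` of `e` is outside `N[h]`
      obtain ⟨v, hv⟩ := Sym2.mem_iff_exists.1 hxe
      have hvh : v ≠ h := by rintro rfl; exact he (by rw [hv]; exact Sym2.mem_mk_right _ _)
      have hvn : v ∉ nbr ends h := fun hvn => hs.indep e x v hv hx hvn
      have hvU : v ∉ closedNbr ends h := by
        rw [mem_closedNbr]; rintro (rfl | h'); exact hvh rfl; exact hvn h'
      have hxv : x ≠ v := by rintro rfl; exact hs.indep e x x hv hx hx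
      -- the star edge of `x`
      set e₀ := starEdge hs hx with he₀
      have he₀s : ends e₀.1 = s(h, x) := starEdge_spec hs hx
      cases hc : ζ e₀.1
      · -- star edge blue: `x ∈ C_B(h)`; `e` must be red
        cases hζe : ζ e
        · exfalso
          have hxB : x ∈ cluster ends (blue ζ) h :=
            conn_of_openAdj ⟨e₀.1, by rw [blue_apply, hc]; rfl, he₀s⟩
          have hvB : v ∈ cluster ends (blue ζ) h :=
            mem_cluster_of_adj hxB (openGraph_adj.2 ⟨hxv, e, by rw [blue_apply, hζe]; rfl, hv⟩)
          exact hvU (hhull (Or.inr hvB))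
        · rfl
      · -- star edge red: `x ∈ C_R(h)`; `e` must be blue
        cases hζe : ζ e
        · rfl
        · exfalso
          have hxR : x ∈ cluster ends ζ h := conn_of_openAdj ⟨e₀.1, hc, he₀s⟩
          have hvR : v ∈ cluster ends ζ h :=
            mem_cluster_of_adj hxR (openGraph_adj.2 ⟨hxv, e, hζe, hv⟩)
          exact hvU (hhull (Or.inl hvR))
    · have hn : ∀ x ∈ nbr ends h, x ∉ ends e := fun x hx' hxe => hx ⟨x, hx', hxe⟩
      rw [starRealize_out hs ξ _ he hn]
      apply hout
      intro ht
      obtain ⟨y, hy, z, hyz⟩ := mem_touches.1 ht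
      rw [mem_closedNbr] at hy
      rcases hy with rfl | hy
      · exact he (by rw [hyz]; exact Sym2.mem_mk_left _ _)
      · exact hn y hy (by rw [hyz]; exact Sym2.mem_mk_left _ _)

end LocRows

end Summit.Ventures.PercRepro2
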